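import Summits.BirchSwinnertonDyer.BirchSwinnertonDyer.Theorems.PrintCf2SplitBadTwoSelmerCountAtOnePlace
import Summits.BirchSwinnertonDyer.Rank1Residual.X11b.PropagatedUnramified
import Summits.BirchSwinnertonDyer.Rank1Residual.X11b.LevelLiftingLower
import HarnessLib

/-!
# Crux `PrintCf2.SplitBadTwoRankOneOfFacts` (stmt-BirchSwinnertonDyer-20368), road α v10.3, S3c input (F3), piece (P2)-frame:
# the one-relaxed-place Poitou–Tate count for the TORSION-STRICT level structure on `E[p^N]`

Cell `bsd-print-cf2`, EXTRA WIDTH seat `bsd-line-cf2-p1-w4` g9 (prover-bsd-line-cf2-p1-w4-g9-0); `--supports stmt-BirchSwinnertonDyer-20368`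
(helper, Theses-free). HONEST FRAMING: nothing here closes the crux or a registered stub; BSD is not proved by any of this; no summit
statement is proved by this seat. No definition, no named fact, no `sorry`. This is the frame instantiation «Option A‴» (cell STATUS, this seat,
DESIGN DECISION) of (P2) = p675312 for -w5 g3's (F3) plan `Cruxes/SplitBadTwoRankOneOfFacts/F3-PLAN-w5g3.md`: the level module is X11b's FULL
`E[p^N]` (`torsionGaloisModule`), the structure `𝓕` is TORSION-STRICT away from `v` — at every finite `w ≠ v` the condition
`N^E_w = ker(H¹(K_w, E[p^N]) → H¹(K_w, E[p^∞]))` (the classes dying in `H¹(K_w, E[p^∞])`; `= H¹_ur` at good `w ∤ p`, X11b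
`ker_map_primaryInclusion_restrictField_eq_unramifiedSubgroup`) — and ARBITRARY (`L_v := 𝓕_v`) at `v`; `𝓖 := 𝓕[⊤ at v]`.

WHAT. `relIndex_selmerGroup_update_top_mul_eq_sq` (generic `V/K` elliptic over a number field, prime `p`, level `N ≥ 1`, finite place `v`,
`T ⊇ ∞ ∪ {w ∣ p} ∪ {bad}` with `v ∈ T`, the level-`p^N` Poitou–Tate family `inv` — `poitouTate_selmerStructure_duality K` provides it):
  **`[H¹_{𝓕[⊤ at v]}(K, E[p^N]) : H¹_𝓕(K, E[p^N])] · #loc_v(H¹_{𝓕*}(K, E[p^N]^D)) · #𝓕_v = (#E(K_v)[p^N] · #(𝓞_v ⧸ p^N))²`**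
= p675312 `relIndex_selmerGroup_mul_natCard_map_localization_mul_natCard_eq` (Howard Thm. 2.1.11 counted at one relaxed place) × the tree's
`natCard_galoisCohomology_one_torsion_adicCompletion_eq_sq` (`#H¹(K_v, E[n]) = (#E(K_v)[n] · #(𝓞_v/n))²`, Milne I Thm. 2.8 + Cor. 2.3, with the
fact `localEulerPoincareCharacteristic (K_v)` DISCHARGED by the tree's `localEulerPoincareCharacteristic_holds`). The binder `[Finite E[p^N]]` is the tree's
`finite_geomTorsion_of_neZero` (supplied by consumers with `haveI`). Also `relIndex_selmerGroup_update_top_eq`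
(the same with `[𝓕[⊤ at v] : 𝓕]`-side isolated: X11b's relIndex identity for this structure) for consumers who count `[H¹(K_v, E[p^N]) : 𝓕_v]` instead.
USE for (F3) (CM member, `p = 2`, `v ∣ 2` split): `L_v := (N^E_v).comap H¹(e_N)` with `e_N` the level projector onto `W*[2^N]` (p669287
`LevelEigen.exists_levelProj`): then `[H¹_{𝓕[⊤ at v]} : H¹_𝓕] = #range(loc_v | 𝔖_{v̄}(K, W*))` ((P1)-lift, -w5 g3), `#𝓕_v = #N^E_{v,e} · #H¹(K_v, E[2^N])_{e′}`
((P2-loc), -w3 g9), and `#loc_v(H¹_{𝓕*})` is the rank-one dual side (P3).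
presearch: Howard 2004 Thm. 2.1.11 / Milne ADT I Thm. 4.10, 2.8 → tree theorems (X11b `PoitouTateSelmerCounting`, p675312,
`LocalEulerCharacteristicTorsion`); no new fact. beyond-print theorem: no.

References: [Howard2004HeegnerKolyvagin] Def. 2.1.1, Def. 2.1.10, Thm. 2.1.11; [JetchevSkinnerWan2017] §2.2.3, Prop. 3.2.1; [MilneADT2006] I Cor. 2.3,
Thm. 2.8, Thm. 4.10.
-/

noncomputable section

open scoped Classical

set_option linter.dupNamespace false
set_option autoImplicit false

open Function NumberField IsDedekindDomain WeierstrassCurve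
open Literature.NumberTheory.EllipticCurves
open Literature.NumberTheory.GaloisRepresentations
open Literature.NumberTheory.GaloisRepresentations.DiscreteGaloisModule (localTatePairingZMod tateDual SelmerStructure mu)
open Literature.NumberTheory.GaloisCohomology
open Literature.NumberTheory.GaloisCohomology.LocalInvariants
open scoped ContRepresentation
open Summit.BirchSwinnertonDyer.Rank1Residual.X11b

namespace Summit.BirchSwinnertonDyer.BirchSwinnertonDyer.Theorems.PrintCf2.RestrictedSelmerPair

section Frame

variable {K : Type} [Field K] [NumberField K] (V : WeierstrassCurve K) [V.IsElliptic] (p : ℕ) [hp : Fact p.Prime] (N : ℕ)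

omit [NumberField K] [V.IsElliptic] hp in
/-- `p^N · T = 0` on `E[p^N]`. [folklore] -/
theorem pow_smul_geomTorsion_eq_zero (m : V.geomTorsion ((p ^ N : ℕ) : ℤ)) : p ^ N • m = 0 :=
  AddSubgroup.torsionBy.nsmul m

/-- **(P2)-frame, Option A‴: `[H¹_{𝓕[⊤ at v]}(K, E[p^N]) : H¹_𝓕(K, E[p^N])] · #loc_v(H¹_{𝓕*}(K, E[p^N]^D)) · #𝓕_v = (#E(K_v)[p^N] · #(𝓞_v ⧸ p^N))²`**
for the TORSION-STRICT structure `𝓕` on the full level module `E[p^N]` (`𝓕_w = ker(H¹(K_w, E[p^N]) → H¹(K_w, E[p^∞]))` at every finite `w ≠ v`,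
anything at `v` and at the infinite places), `T ⊇ ∞ ∪ {w ∣ p} ∪ {bad} ∋ v`, `N ≥ 1`, `inv` the level-`p^N` Poitou–Tate family: p675312 (Howard Thm. 2.1.11
at one relaxed place, counted) with `𝓕` unramified outside `T` (X11b `ker_map_primaryInclusion_restrictField_eq_unramifiedSubgroup`,
`isUnramifiedAt_torsionGaloisModule`) and `#H¹(K_v, E[p^N]) = (#E(K_v)[p^N] · #(𝓞_v/p^N))²` (Milne I Thm. 2.8 + Cor. 2.3; the tree's
`natCard_galoisCohomology_one_torsion_adicCompletion_eq_sq`, its `hEP` discharged by `localEulerPoincareCharacteristic_holds`).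
[cite: Howard2004HeegnerKolyvagin, Thm. 2.1.11 (arXiv:1202.6340 p. 6)] [cite: MilneADT2006, I Thm. 2.8, Cor. 2.3 and Thm. 4.10]
[cite: JetchevSkinnerWan2017, §2.2.3 and Prop. 3.2.1 (arXiv:1512.06894 pp. 7, 10)] -/
theorem relIndex_selmerGroup_update_top_mul_eq_sq [Finite (V.geomTorsion ((p ^ N : ℕ) : ℤ))] (hN : 0 < N)
    {inv : LocalInvariants K (p ^ N)} (hperf : inv.IsPerfect)
    (hvan : inv.SumLocalTermEqZero) (hcomp : inv.SelmerComplement) (T : Finset (Place K))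
    (hinf : ∀ w : InfinitePlace K, (Sum.inl w : Place K) ∈ T)
    (hpT : ∀ w : HeightOneSpectrum (𝓞 K), ((p : ℕ) : 𝓞 K) ∈ w.asIdeal → (Sum.inr w : Place K) ∈ T)
    (hbad : ∀ w : HeightOneSpectrum (𝓞 K), ¬ V.HasGoodReductionAt w → (Sum.inr w : Place K) ∈ T)
    (v : HeightOneSpectrum (𝓞 K)) (hv : (Sum.inr v : Place K) ∈ T) (𝓕 : SelmerStructure (V.torsionGaloisModule ((p ^ N : ℕ) : ℤ)))
    (h𝓕 : ∀ w : HeightOneSpectrum (𝓞 K), w ≠ v →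
      𝓕 (Sum.inr w) = (galoisCohomology.map ((Levels.primaryInclusion V p N).restrictField (w.adicCompletion K)) 1).ker) :
    𝓕.selmerGroup.relIndex (SelmerStructure.selmerGroup (Function.update 𝓕 (Sum.inr v : Place K) ⊤)) *
        Nat.card ((inv.dualSelmerStructure (V.torsionGaloisModule ((p ^ N : ℕ) : ℤ)) 𝓕).selmerGroup.map
          (galoisCohomology.localization ((V.torsionGaloisModule ((p ^ N : ℕ) : ℤ)).tateDual (p ^ N)) (Sum.inr v : Place K) 1)) *
        Nat.card (𝓕 (Sum.inr v)) =
      (Nat.card (nsmulAddMonoidHom (p ^ N) : (V.baseChange (v.adicCompletion K)).toAffine.Point →+ _).ker *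
        Nat.card (v.adicCompletionIntegers K ⧸ Ideal.span {((p ^ N : ℕ) : v.adicCompletionIntegers K)})) ^ 2 := by
  haveI : NeZero (p ^ N) := ⟨pow_ne_zero N hp.out.ne_zero⟩
  have hM : ∀ m : V.geomTorsion ((p ^ N : ℕ) : ℤ), p ^ N • m = 0 := pow_smul_geomTorsion_eq_zero V p N
  have hne : ∀ w : HeightOneSpectrum (𝓞 K), (Sum.inr w : Place K) ∉ T → w ≠ v := fun w hw h ↦ hw (h ▸ hv)
  have hpw : ∀ w : HeightOneSpectrum (𝓞 K), (Sum.inr w : Place K) ∉ T → ((p : ℕ) : 𝓞 K) ∉ w.asIdeal :=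
    fun w hw h ↦ hw (hpT w h)
  have hgood : ∀ w : HeightOneSpectrum (𝓞 K), (Sum.inr w : Place K) ∉ T → V.HasGoodReductionAt w := fun w hw ↦ by
    by_contra h
    exact hw (hbad w h)
  have hS : ∀ w : HeightOneSpectrum (𝓞 K), (Sum.inr w : Place K) ∉ T →
      ((p ^ N : ℕ) : 𝓞 K) ∉ w.asIdeal ∧ GaloisRep.IsUnramifiedAt w (V.torsionGaloisModule ((p ^ N : ℕ) : ℤ)) := fun w hw ↦ by
    refine ⟨?_, AcSelmer.isUnramifiedAt_torsionGaloisModule V (hgood w hw) (AcSelmer.intCast_pow_not_mem p (hpw w hw) N)⟩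
    rw [Nat.cast_pow]
    exact fun h ↦ hpw w hw (w.isPrime.mem_of_pow_mem N h)
  have h𝓕ur : 𝓕.IsUnramifiedOutside T := by
    refine ⟨hinf, fun w hw ↦ ?_⟩
    rw [h𝓕 w (hne w hw)]
    exact AcSelmer.ker_map_primaryInclusion_restrictField_eq_unramifiedSubgroup V p N (hpw w hw) (hgood w hw)
  have hne' : ∀ w : HeightOneSpectrum (𝓞 K), (Sum.inr w : Place K) ∉ T → (Sum.inr w : Place K) ≠ Sum.inr v :=
    fun w hw h ↦ hne w hw (Sum.inr_injective h)
  have h𝓖ur : SelmerStructure.IsUnramifiedOutside (Function.update 𝓕 (Sum.inr v : Place K) ⊤) T := by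
    refine ⟨hinf, fun w hw ↦ ?_⟩
    rw [Function.update_of_ne (hne' w hw)]
    exact h𝓕ur.2 w hw
  have hle : 𝓕 ≤ Function.update 𝓕 (Sum.inr v : Place K) ⊤ := by
    intro w
    by_cases hw : w = Sum.inr v
    · subst hw
      rw [Function.update_self]
      exact le_top
    · rw [Function.update_of_ne hw]
  have heq : ∀ w ≠ (Sum.inr v : Place K), 𝓕 w = Function.update 𝓕 (Sum.inr v : Place K) ⊤ w :=
    fun w hw ↦ (Function.update_of_ne hw _ _).symm
  have htop : Function.update 𝓕 (Sum.inr v : Place K) ⊤ (Sum.inr v) = ⊤ := Function.update_self _ _ _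
  rw [relIndex_selmerGroup_mul_natCard_map_localization_mul_natCard_eq hperf hvan hcomp hM hS hle h𝓕ur h𝓖ur hv heq htop]
  have hpp : IsPrimePow (p ^ N) := ⟨p, N, hp.out.prime, hN, rfl⟩
  exact natCard_galoisCohomology_one_torsion_adicCompletion_eq_sq V v (p ^ N) hpp
    (localEulerPoincareCharacteristic_adicCompletion_of_numberField v)

/-- **The `[𝓕[⊤ at v] : 𝓕]` side alone** (no local count): `[H¹_{𝓕[⊤ at v]} : H¹_𝓕] · [H¹_{𝓕*}(K, E[p^N]^D) : H¹_{𝓕[⊤ at v]*}(K, E[p^N]^D)] = [H¹(K_v, E[p^N]) : 𝓕_v]`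
for the torsion-strict structure — X11b `PoitouTateCounting.relIndex_selmerGroup_mul_relIndex_dual_eq` with the unramifiedness hypotheses
discharged as above. [cite: Howard2004HeegnerKolyvagin, Thm. 2.1.11 (arXiv:1202.6340 p. 6)] [cite: MilneADT2006, I Thm. 4.10] -/
theorem relIndex_selmerGroup_update_top_eq [Finite (V.geomTorsion ((p ^ N : ℕ) : ℤ))]
    {inv : LocalInvariants K (p ^ N)} (hperf : inv.IsPerfect)
    (hvan : inv.SumLocalTermEqZero) (hcomp : inv.SelmerComplement) (T : Finset (Place K))
    (hinf : ∀ w : InfinitePlace K, (Sum.inl w : Place K) ∈ T)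
    (hpT : ∀ w : HeightOneSpectrum (𝓞 K), ((p : ℕ) : 𝓞 K) ∈ w.asIdeal → (Sum.inr w : Place K) ∈ T)
    (hbad : ∀ w : HeightOneSpectrum (𝓞 K), ¬ V.HasGoodReductionAt w → (Sum.inr w : Place K) ∈ T)
    (v : HeightOneSpectrum (𝓞 K)) (hv : (Sum.inr v : Place K) ∈ T) (𝓕 : SelmerStructure (V.torsionGaloisModule ((p ^ N : ℕ) : ℤ)))
    (h𝓕 : ∀ w : HeightOneSpectrum (𝓞 K), w ≠ v →
      𝓕 (Sum.inr w) = (galoisCohomology.map ((Levels.primaryInclusion V p N).restrictField (w.adicCompletion K)) 1).ker) :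
    𝓕.selmerGroup.relIndex (SelmerStructure.selmerGroup (Function.update 𝓕 (Sum.inr v : Place K) ⊤)) *
        (inv.dualSelmerStructure (V.torsionGaloisModule ((p ^ N : ℕ) : ℤ)) (Function.update 𝓕 (Sum.inr v) ⊤)).selmerGroup.relIndex
          (inv.dualSelmerStructure (V.torsionGaloisModule ((p ^ N : ℕ) : ℤ)) 𝓕).selmerGroup =
      (𝓕 (Sum.inr v)).index := by
  haveI : NeZero (p ^ N) := ⟨pow_ne_zero N hp.out.ne_zero⟩
  have hM : ∀ m : V.geomTorsion ((p ^ N : ℕ) : ℤ), p ^ N • m = 0 := pow_smul_geomTorsion_eq_zero V p N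
  have hne : ∀ w : HeightOneSpectrum (𝓞 K), (Sum.inr w : Place K) ∉ T → w ≠ v := fun w hw h ↦ hw (h ▸ hv)
  have hpw : ∀ w : HeightOneSpectrum (𝓞 K), (Sum.inr w : Place K) ∉ T → ((p : ℕ) : 𝓞 K) ∉ w.asIdeal :=
    fun w hw h ↦ hw (hpT w h)
  have hgood : ∀ w : HeightOneSpectrum (𝓞 K), (Sum.inr w : Place K) ∉ T → V.HasGoodReductionAt w := fun w hw ↦ by
    by_contra h
    exact hw (hbad w h)
  have hS : ∀ w : HeightOneSpectrum (𝓞 K), (Sum.inr w : Place K) ∉ T →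
      ((p ^ N : ℕ) : 𝓞 K) ∉ w.asIdeal ∧ GaloisRep.IsUnramifiedAt w (V.torsionGaloisModule ((p ^ N : ℕ) : ℤ)) := fun w hw ↦ by
    refine ⟨?_, AcSelmer.isUnramifiedAt_torsionGaloisModule V (hgood w hw) (AcSelmer.intCast_pow_not_mem p (hpw w hw) N)⟩
    rw [Nat.cast_pow]
    exact fun h ↦ hpw w hw (w.isPrime.mem_of_pow_mem N h)
  have h𝓕ur : 𝓕.IsUnramifiedOutside T := by
    refine ⟨hinf, fun w hw ↦ ?_⟩
    rw [h𝓕 w (hne w hw)]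
    exact AcSelmer.ker_map_primaryInclusion_restrictField_eq_unramifiedSubgroup V p N (hpw w hw) (hgood w hw)
  have hne' : ∀ w : HeightOneSpectrum (𝓞 K), (Sum.inr w : Place K) ∉ T → (Sum.inr w : Place K) ≠ Sum.inr v :=
    fun w hw h ↦ hne w hw (Sum.inr_injective h)
  have h𝓖ur : SelmerStructure.IsUnramifiedOutside (Function.update 𝓕 (Sum.inr v : Place K) ⊤) T := by
    refine ⟨hinf, fun w hw ↦ ?_⟩
    rw [Function.update_of_ne (hne' w hw)]
    exact h𝓕ur.2 w hw
  have hle : 𝓕 ≤ Function.update 𝓕 (Sum.inr v : Place K) ⊤ := by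
    intro w
    by_cases hw : w = Sum.inr v
    · subst hw
      rw [Function.update_self]
      exact le_top
    · rw [Function.update_of_ne hw]
  have heq : ∀ w ≠ (Sum.inr v : Place K), 𝓕 w = Function.update 𝓕 (Sum.inr v : Place K) ⊤ w :=
    fun w hw ↦ (Function.update_of_ne hw _ _).symm
  rw [PoitouTateCounting.relIndex_selmerGroup_mul_relIndex_dual_eq hperf hvan hcomp hM hS hle h𝓕ur h𝓖ur hv heq,
    Function.update_self, AddSubgroup.relIndex_top_right]

end Frame

end Summit.BirchSwinnertonDyer.BirchSwinnertonDyer.Theorems.PrintCf2.RestrictedSelmerPair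

end
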